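import Summits.KontsevichZagierPeriods.KontsevichZagierPeriods.Theses.TerasomaMultiplication
import Literature.NumberTheory.Transcendental.KZHomotopyMoves
import Literature.NumberTheory.Transcendental.SemialgebraicRpow
import Literature.NumberTheory.Transcendental.SemialgebraicLineDeriv
import Literature.NumberTheory.Transcendental.KZLogCalculusProofs
import Literature.NumberTheory.Transcendental.KZProductIdeal

/-!
# `MultiplicationAccessible` (stmt-KontsevichZagierPeriods-12305), line `shifted-family-prime-sieve`:
pointwise facts for the `θ₁`-direction Newton–Leibniz move of the corner Stokes at `p = 3`

The Liouville rotation flow proves the shifted Gauss triplication by Stokes on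
`W = {(θ₁, θ₂, y, v)}` (corner blow-up chart of the cube, `t_k = 1 − yθ_k`, times `(0,1)_v`).
This file collects the elementary estimates on `W` used by the `θ₁`-move (`cornerStokesTheta1Aux`,
`cornerStokesTheta1`): the atoms `Z = (t₀t₁t₂)^{1/3} ∈ (0,1)`, `S` (with `yS = 1 − t₀t₁t₂`, so
`1/3 ≤ S ≤ 10`), `H = (1+Z+Z²)/S ∈ (0, 9]`, `K ∈ (0,1]`, the monomials `M_k ∈ [1 − xy, 1]`,
`M_k ≤ Z²`, the bracket `|θ₀M0 − (1−θ₁)M1 + θ₂M2| ≤ 2xy` (it vanishes at `y = 0`),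
`0 ≤ P ≤ 9^{3s}` (packaged as the sub-goal `cornerStokesTheta1Facts`), and the `θ₁`-derivative of
`Z` with the compensated bound `|∂θ₁Z|·Z² ≤ y/3`.
References: Kontsevich–Zagier 2001 §1.2 rule (3); Andrews–Askey–Roy 1999 pp. 30–31.
-/

noncomputable section

open MeasureTheory Set Real
open scoped BigOperators
open Literature.NumberTheory.Transcendental
open Literature.NumberTheory.Transcendental.KZ
open Literature.ModelTheory.ExponentialFields (IsSemialgebraic isSemialgebraic_setOf_eval_pos
  isSemialgebraic_setOf_eval_lt)
open MvPolynomial (aeval X C)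

namespace Summit.KontsevichZagierPeriods.TerasomaMultiplication.MultiplicationAccessible

namespace CornerTheta1

/-- On `W`: `y < 3`, the three angles and the three box coordinates lie in `(0,1)`. [folklore] -/
theorem basic {w : Fin 4 → ℝ}
    (hw : 0 < w 0 ∧ 0 < w 1 ∧ w 0 + w 1 < 1 ∧ 0 < w 2 ∧ w 2 * (1 - w 0 - w 1) < 1 ∧ w 2 * w 0 < 1 ∧
      w 2 * w 1 < 1 ∧ 0 < w 3 ∧ w 3 < 1) :
    w 2 < 3 ∧ (0 < 1 - w 2 * (1 - w 0 - w 1) ∧ 1 - w 2 * (1 - w 0 - w 1) < 1) ∧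
      (0 < 1 - w 2 * w 0 ∧ 1 - w 2 * w 0 < 1) ∧ (0 < 1 - w 2 * w 1 ∧ 1 - w 2 * w 1 < 1) ∧
      (0 < (1 - w 0 - w 1) * w 0 * w 1 ∧ (1 - w 0 - w 1) * w 0 * w 1 < 1) := by
  obtain ⟨h0, h1, h01, hy, ha, hb, hc, -, -⟩ := hw
  have hθ : 0 < 1 - w 0 - w 1 := by linarith
  have ha' : 0 < w 2 * (1 - w 0 - w 1) := mul_pos hy hθ
  have hb' : 0 < w 2 * w 0 := mul_pos hy h0
  have hc' : 0 < w 2 * w 1 := mul_pos hy h1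
  refine ⟨by nlinarith, ⟨by linarith, by linarith⟩, ⟨by linarith, by linarith⟩, ⟨by linarith, by linarith⟩,
    by positivity, ?_⟩
  calc (1 - w 0 - w 1) * w 0 * w 1 < 1 * 1 * 1 := by
        gcongr <;> linarith
    _ = 1 := by ring

/-- The key identity `y · S = 1 − t₀t₁t₂`. [folklore] -/
theorem y_mul_S {S : (Fin 4 → ℝ) → ℝ}
    (hS : ∀ w, S w = 1 - w 2 * ((1 - w 0 - w 1) * w 0 + (1 - w 0 - w 1) * w 1 + w 0 * w 1) +
      (w 2) ^ 2 * ((1 - w 0 - w 1) * w 0 * w 1)) (w : Fin 4 → ℝ) :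
    w 2 * S w = 1 - (1 - w 2 * (1 - w 0 - w 1)) * (1 - w 2 * w 0) * (1 - w 2 * w 1) := by
  rw [hS]; ring

/-- On `W`: `1/3 ≤ S ≤ 10`. [folklore] -/
theorem S_mem {S : (Fin 4 → ℝ) → ℝ}
    (hS : ∀ w, S w = 1 - w 2 * ((1 - w 0 - w 1) * w 0 + (1 - w 0 - w 1) * w 1 + w 0 * w 1) +
      (w 2) ^ 2 * ((1 - w 0 - w 1) * w 0 * w 1)) {w : Fin 4 → ℝ}
    (hw : 0 < w 0 ∧ 0 < w 1 ∧ w 0 + w 1 < 1 ∧ 0 < w 2 ∧ w 2 * (1 - w 0 - w 1) < 1 ∧ w 2 * w 0 < 1 ∧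
      w 2 * w 1 < 1 ∧ 0 < w 3 ∧ w 3 < 1) :
    1/3 ≤ S w ∧ S w ≤ 10 := by
  obtain ⟨hy3, ⟨h0, h0'⟩, ⟨h1, h1'⟩, ⟨h2, h2'⟩, -, he3⟩ := basic hw
  obtain ⟨hθ1, hθ2, h01, hy, -⟩ := hw
  have key := y_mul_S hS w
  constructor
  · -- `y S = 1 - t₀t₁t₂ ≥ 1 - t_k = y θ_k` for each `k`; sum over `k`.
    have e0 : w 2 * S w ≥ w 2 * (1 - w 0 - w 1) := by
      rw [key]; nlinarith [mul_nonneg h1.le h2.le, mul_le_one₀ h1'.le h2.le h2'.le]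
    have e1 : w 2 * S w ≥ w 2 * w 0 := by
      rw [key]; nlinarith [mul_nonneg h0.le h2.le, mul_le_one₀ h0'.le h2.le h2'.le]
    have e2 : w 2 * S w ≥ w 2 * w 1 := by
      rw [key]; nlinarith [mul_nonneg h0.le h1.le, mul_le_one₀ h0'.le h1.le h1'.le]
    have : w 2 * (3 * S w) ≥ w 2 * 1 := by nlinarith
    nlinarith
  · rw [hS]
    nlinarith [mul_pos hθ1 hθ2, mul_pos (show (0:ℝ) < 1 - w 0 - w 1 by linarith) hθ1,
      mul_pos (show (0:ℝ) < 1 - w 0 - w 1 by linarith) hθ2]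

/-- On `W`: `0 < Z < 1`. [folklore] -/
theorem Z_mem {Z : (Fin 4 → ℝ) → ℝ}
    (hZ : ∀ w, Z w = ((1 - w 2 * (1 - w 0 - w 1)) * (1 - w 2 * w 0) * (1 - w 2 * w 1)) ^ ((1:ℝ)/3))
    {w : Fin 4 → ℝ}
    (hw : 0 < w 0 ∧ 0 < w 1 ∧ w 0 + w 1 < 1 ∧ 0 < w 2 ∧ w 2 * (1 - w 0 - w 1) < 1 ∧ w 2 * w 0 < 1 ∧
      w 2 * w 1 < 1 ∧ 0 < w 3 ∧ w 3 < 1) :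
    0 < Z w ∧ Z w < 1 := by
  obtain ⟨-, ⟨h0, h0'⟩, ⟨h1, h1'⟩, ⟨h2, h2'⟩, -⟩ := basic hw
  have hp : 0 < (1 - w 2 * (1 - w 0 - w 1)) * (1 - w 2 * w 0) * (1 - w 2 * w 1) := by positivity
  have hl : (1 - w 2 * (1 - w 0 - w 1)) * (1 - w 2 * w 0) * (1 - w 2 * w 1) < 1 := by
    calc (1 - w 2 * (1 - w 0 - w 1)) * (1 - w 2 * w 0) * (1 - w 2 * w 1) < 1 * 1 * 1 := by
          gcongr
      _ = 1 := by ring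
  rw [hZ]
  exact ⟨rpow_pos_of_pos hp _, rpow_lt_one hp.le hl (by norm_num)⟩

/-- On `W`: `0 < H ≤ 9` (`H = (1 + Z + Z²)/S`, `S ≥ 1/3`). [folklore] -/
theorem H_mem {Z S H : (Fin 4 → ℝ) → ℝ}
    (hZ : ∀ w, Z w = ((1 - w 2 * (1 - w 0 - w 1)) * (1 - w 2 * w 0) * (1 - w 2 * w 1)) ^ ((1:ℝ)/3))
    (hS : ∀ w, S w = 1 - w 2 * ((1 - w 0 - w 1) * w 0 + (1 - w 0 - w 1) * w 1 + w 0 * w 1) +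
      (w 2) ^ 2 * ((1 - w 0 - w 1) * w 0 * w 1))
    (hH : ∀ w, H w = (1 + Z w + Z w ^ 2) / S w) {w : Fin 4 → ℝ}
    (hw : 0 < w 0 ∧ 0 < w 1 ∧ w 0 + w 1 < 1 ∧ 0 < w 2 ∧ w 2 * (1 - w 0 - w 1) < 1 ∧ w 2 * w 0 < 1 ∧
      w 2 * w 1 < 1 ∧ 0 < w 3 ∧ w 3 < 1) :
    0 < H w ∧ H w ≤ 9 := by
  obtain ⟨hz0, hz1⟩ := Z_mem hZ hw
  obtain ⟨hs0, -⟩ := S_mem hS hw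
  have hSpos : 0 < S w := by linarith
  rw [hH]
  refine ⟨div_pos (by nlinarith) hSpos, ?_⟩
  rw [div_le_iff₀ hSpos]
  nlinarith

/-- On `W`: `0 < K ≤ 1`. [folklore] -/
theorem K_mem {s : ℚ} (hs : 3 ≤ s) {K : (Fin 4 → ℝ) → ℝ}
    (hK : ∀ w, K w = ((1 - w 0 - w 1) * w 0 * w 1) ^ ((s:ℝ) - 1)) {w : Fin 4 → ℝ}
    (hw : 0 < w 0 ∧ 0 < w 1 ∧ w 0 + w 1 < 1 ∧ 0 < w 2 ∧ w 2 * (1 - w 0 - w 1) < 1 ∧ w 2 * w 0 < 1 ∧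
      w 2 * w 1 < 1 ∧ 0 < w 3 ∧ w 3 < 1) :
    0 < K w ∧ K w ≤ 1 := by
  obtain ⟨-, -, -, -, hb, hb'⟩ := basic hw
  have hs' : (0:ℝ) ≤ (s:ℝ) - 1 := by
    have : (3:ℝ) ≤ s := by exact_mod_cast hs
    linarith
  rw [hK]
  exact ⟨rpow_pos_of_pos hb _, rpow_le_one hb.le hb'.le hs'⟩

/-- A monomial `t₀^α t₁^β t₂^γ` in box coordinates `t_k ∈ (0,1]` with exponents `≥ 2/3` is at most
`ζ² = (t₀t₁t₂)^{2/3}`. [folklore] -/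
theorem monomial_le_zeta_sq {t₀ t₁ t₂ α β γ : ℝ} (h0 : 0 < t₀) (h0' : t₀ ≤ 1) (h1 : 0 < t₁)
    (h1' : t₁ ≤ 1) (h2 : 0 < t₂) (h2' : t₂ ≤ 1) (hα : 2/3 ≤ α) (hβ : 2/3 ≤ β) (hγ : 2/3 ≤ γ) :
    0 ≤ t₀ ^ α * t₁ ^ β * t₂ ^ γ ∧
      t₀ ^ α * t₁ ^ β * t₂ ^ γ ≤ ((t₀ * t₁ * t₂) ^ ((1:ℝ)/3)) ^ 2 := by
  refine ⟨by positivity, ?_⟩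
  have e : ((t₀ * t₁ * t₂) ^ ((1:ℝ)/3)) ^ 2 = t₀ ^ ((2:ℝ)/3) * t₁ ^ ((2:ℝ)/3) * t₂ ^ ((2:ℝ)/3) := by
    rw [← rpow_natCast, ← rpow_mul (by positivity), mul_rpow (by positivity) h2.le,
      mul_rpow h0.le h1.le]
    norm_num
  rw [e]
  have a0 := rpow_le_rpow_of_exponent_ge h0 h0' hα
  have a1 := rpow_le_rpow_of_exponent_ge h1 h1' hβ
  have a2 := rpow_le_rpow_of_exponent_ge h2 h2' hγ
  gcongr

/-- Bernoulli: `1 − t^α ≤ α (1 − t)` for `t ∈ [0,1]`, `α ≥ 1`. [folklore] -/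
theorem one_sub_rpow_le {t α : ℝ} (ht : 0 ≤ t) (hα : 1 ≤ α) : 1 - t ^ α ≤ α * (1 - t) := by
  have h := one_add_mul_self_le_rpow_one_add (s := t - 1) (by linarith) hα
  rw [show 1 + (t - 1) = t by ring] at h
  linarith

/-- `1 − t₀^α t₁^β t₂^γ ≤ x((1−t₀) + (1−t₁) + (1−t₂))` for `t_k ∈ [0,1]` and exponents in `[1, x]`.
[folklore] -/
theorem one_sub_monomial_le {x t₀ t₁ t₂ α β γ : ℝ} (h0 : 0 ≤ t₀) (h0' : t₀ ≤ 1) (h1 : 0 ≤ t₁)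
    (h1' : t₁ ≤ 1) (h2 : 0 ≤ t₂) (h2' : t₂ ≤ 1) (hα : 1 ≤ α) (hβ : 1 ≤ β) (hγ : 1 ≤ γ) (hαx : α ≤ x)
    (hβx : β ≤ x) (hγx : γ ≤ x) :
    t₀ ^ α * t₁ ^ β * t₂ ^ γ ≤ 1 ∧
      1 - t₀ ^ α * t₁ ^ β * t₂ ^ γ ≤ x * ((1 - t₀) + (1 - t₁) + (1 - t₂)) := by
  have a0 : t₀ ^ α ≤ 1 := rpow_le_one h0 h0' (by linarith)
  have a1 : t₁ ^ β ≤ 1 := rpow_le_one h1 h1' (by linarith)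
  have a2 : t₂ ^ γ ≤ 1 := rpow_le_one h2 h2' (by linarith)
  have b0 : 0 ≤ t₀ ^ α := rpow_nonneg h0 _
  have b1 : 0 ≤ t₁ ^ β := rpow_nonneg h1 _
  have b2 : 0 ≤ t₂ ^ γ := rpow_nonneg h2 _
  have c0 := one_sub_rpow_le h0 hα
  have c1 := one_sub_rpow_le h1 hβ
  have c2 := one_sub_rpow_le h2 hγ
  refine ⟨?_, ?_⟩
  · calc t₀ ^ α * t₁ ^ β * t₂ ^ γ ≤ 1 * 1 * 1 := by gcongr
      _ = 1 := by ring
  · have h3 : 1 - t₀ ^ α * t₁ ^ β * t₂ ^ γ ≤ (1 - t₀ ^ α) + (1 - t₁ ^ β) + (1 - t₂ ^ γ) := by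
      nlinarith [mul_nonneg b0 b1, mul_le_mul a0 a1 b1 zero_le_one]
    have d0 : α * (1 - t₀) ≤ x * (1 - t₀) := mul_le_mul_of_nonneg_right hαx (by linarith)
    have d1 : β * (1 - t₁) ≤ x * (1 - t₁) := mul_le_mul_of_nonneg_right hβx (by linarith)
    have d2 : γ * (1 - t₂) ≤ x * (1 - t₂) := mul_le_mul_of_nonneg_right hγx (by linarith)
    nlinarith

/-- On `W` (`x ≥ 2`): each `M_k` lies in `[1 − xy, 1]` and is at most `Z²`. [folklore] -/
theorem M_mem {x : ℚ} (hx : 2 ≤ x) {Z M0 M1 M2 : (Fin 4 → ℝ) → ℝ}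
    (hZ : ∀ w, Z w = ((1 - w 2 * (1 - w 0 - w 1)) * (1 - w 2 * w 0) * (1 - w 2 * w 1)) ^ ((1:ℝ)/3))
    (hM0 : ∀ w, M0 w = (1 - w 2 * (1 - w 0 - w 1)) ^ (x:ℝ) * (1 - w 2 * w 0) ^ ((x:ℝ) - 2/3) *
      (1 - w 2 * w 1) ^ ((x:ℝ) - 1/3))
    (hM1 : ∀ w, M1 w = (1 - w 2 * (1 - w 0 - w 1)) ^ ((x:ℝ) - 1/3) * (1 - w 2 * w 0) ^ (x:ℝ) *
      (1 - w 2 * w 1) ^ ((x:ℝ) - 2/3))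
    (hM2 : ∀ w, M2 w = (1 - w 2 * (1 - w 0 - w 1)) ^ ((x:ℝ) - 2/3) * (1 - w 2 * w 0) ^ ((x:ℝ) - 1/3) *
      (1 - w 2 * w 1) ^ (x:ℝ))
    {w : Fin 4 → ℝ}
    (hw : 0 < w 0 ∧ 0 < w 1 ∧ w 0 + w 1 < 1 ∧ 0 < w 2 ∧ w 2 * (1 - w 0 - w 1) < 1 ∧ w 2 * w 0 < 1 ∧
      w 2 * w 1 < 1 ∧ 0 < w 3 ∧ w 3 < 1) :
    (0 ≤ M0 w ∧ M0 w ≤ 1 ∧ M0 w ≤ Z w ^ 2 ∧ 1 - M0 w ≤ x * w 2) ∧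
      (0 ≤ M1 w ∧ M1 w ≤ 1 ∧ M1 w ≤ Z w ^ 2 ∧ 1 - M1 w ≤ x * w 2) ∧
      (0 ≤ M2 w ∧ M2 w ≤ 1 ∧ M2 w ≤ Z w ^ 2 ∧ 1 - M2 w ≤ x * w 2) := by
  obtain ⟨-, ⟨h0, h0'⟩, ⟨h1, h1'⟩, ⟨h2, h2'⟩, -⟩ := basic hw
  have hx' : (2:ℝ) ≤ x := by exact_mod_cast hx
  have hsum : (1 - (1 - w 2 * (1 - w 0 - w 1))) + (1 - (1 - w 2 * w 0)) + (1 - (1 - w 2 * w 1)) =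
      w 2 := by ring
  have key : ∀ {α β γ : ℝ}, 1 ≤ α → 1 ≤ β → 1 ≤ γ → α ≤ x → β ≤ x → γ ≤ x →
      0 ≤ (1 - w 2 * (1 - w 0 - w 1)) ^ α * (1 - w 2 * w 0) ^ β * (1 - w 2 * w 1) ^ γ ∧
      (1 - w 2 * (1 - w 0 - w 1)) ^ α * (1 - w 2 * w 0) ^ β * (1 - w 2 * w 1) ^ γ ≤ 1 ∧
      (1 - w 2 * (1 - w 0 - w 1)) ^ α * (1 - w 2 * w 0) ^ β * (1 - w 2 * w 1) ^ γ ≤ Z w ^ 2 ∧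
      1 - (1 - w 2 * (1 - w 0 - w 1)) ^ α * (1 - w 2 * w 0) ^ β * (1 - w 2 * w 1) ^ γ ≤ x * w 2 := by
    intro α β γ hα hβ hγ hαx hβx hγx
    obtain ⟨hn, hz⟩ := monomial_le_zeta_sq h0 h0'.le h1 h1'.le h2 h2'.le (by linarith) (by linarith)
      (by linarith) (α := α) (β := β) (γ := γ)
    obtain ⟨hle, hsub⟩ := one_sub_monomial_le h0.le h0'.le h1.le h1'.le h2.le h2'.le hα hβ hγ hαx
      hβx hγx
    rw [hsum] at hsub
    rw [hZ]
    exact ⟨hn, hle, hz, hsub⟩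
  rw [hM0, hM1, hM2]
  exact ⟨key (by linarith) (by linarith) (by linarith) le_rfl (by linarith) (by linarith),
    key (by linarith) (by linarith) (by linarith) (by linarith) le_rfl (by linarith),
    key (by linarith) (by linarith) (by linarith) (by linarith) (by linarith) le_rfl⟩

/-- On `W` (`x ≥ 2`) the bracket `B = θ₀M0 − (1−θ₁)M1 + θ₂M2` of `c₀` satisfies `|B| ≤ 2xy` (it
vanishes at `y = 0`) and `|B| ≤ 2Z²`. [folklore] -/
theorem B_bounds {x : ℚ} (hx : 2 ≤ x) {Z M0 M1 M2 : (Fin 4 → ℝ) → ℝ}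
    (hZ : ∀ w, Z w = ((1 - w 2 * (1 - w 0 - w 1)) * (1 - w 2 * w 0) * (1 - w 2 * w 1)) ^ ((1:ℝ)/3))
    (hM0 : ∀ w, M0 w = (1 - w 2 * (1 - w 0 - w 1)) ^ (x:ℝ) * (1 - w 2 * w 0) ^ ((x:ℝ) - 2/3) *
      (1 - w 2 * w 1) ^ ((x:ℝ) - 1/3))
    (hM1 : ∀ w, M1 w = (1 - w 2 * (1 - w 0 - w 1)) ^ ((x:ℝ) - 1/3) * (1 - w 2 * w 0) ^ (x:ℝ) *
      (1 - w 2 * w 1) ^ ((x:ℝ) - 2/3))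
    (hM2 : ∀ w, M2 w = (1 - w 2 * (1 - w 0 - w 1)) ^ ((x:ℝ) - 2/3) * (1 - w 2 * w 0) ^ ((x:ℝ) - 1/3) *
      (1 - w 2 * w 1) ^ (x:ℝ))
    {w : Fin 4 → ℝ}
    (hw : 0 < w 0 ∧ 0 < w 1 ∧ w 0 + w 1 < 1 ∧ 0 < w 2 ∧ w 2 * (1 - w 0 - w 1) < 1 ∧ w 2 * w 0 < 1 ∧
      w 2 * w 1 < 1 ∧ 0 < w 3 ∧ w 3 < 1) :
    |(1 - w 0 - w 1) * M0 w - (1 - w 0) * M1 w + w 1 * M2 w| ≤ 2 * x * w 2 ∧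
      |(1 - w 0 - w 1) * M0 w - (1 - w 0) * M1 w + w 1 * M2 w| ≤ 2 * Z w ^ 2 := by
  obtain ⟨⟨a0, a1, a2, a3⟩, ⟨b0, b1, b2, b3⟩, ⟨c0, c1, c2, c3⟩⟩ := M_mem hx hZ hM0 hM1 hM2 hw
  obtain ⟨hθ1, hθ2, h01, hy, -⟩ := hw
  have hθ0 : 0 < 1 - w 0 - w 1 := by linarith
  have hxy : 0 ≤ (x:ℝ) * w 2 := by
    have : (2:ℝ) ≤ x := by exact_mod_cast hx
    positivity
  have e : (1 - w 0 - w 1) * M0 w - (1 - w 0) * M1 w + w 1 * M2 w =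
      (1 - w 0 - w 1) * (M0 w - M1 w) + w 1 * (M2 w - M1 w) := by ring
  constructor
  · rw [e, abs_le]
    have d1 : |M0 w - M1 w| ≤ x * w 2 := by rw [abs_le]; constructor <;> linarith
    have d2 : |M2 w - M1 w| ≤ x * w 2 := by rw [abs_le]; constructor <;> linarith
    rw [abs_le] at d1 d2
    constructor <;> nlinarith [mul_le_mul_of_nonneg_left d1.1 hθ0.le,
      mul_le_mul_of_nonneg_left d1.2 hθ0.le, mul_le_mul_of_nonneg_left d2.1 hθ2.le,
      mul_le_mul_of_nonneg_left d2.2 hθ2.le]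
  · rw [abs_le]
    constructor <;> nlinarith [mul_le_mul_of_nonneg_left a2 hθ0.le,
      mul_le_mul_of_nonneg_left b2 (show (0:ℝ) ≤ 1 - w 0 by linarith),
      mul_le_mul_of_nonneg_left c2 hθ2.le, mul_nonneg hθ0.le a0,
      mul_nonneg (show (0:ℝ) ≤ 1 - w 0 by linarith) b0, mul_nonneg hθ2.le c0, sq_nonneg (Z w)]

/-- On `W`: the factors of `P` — `v^{3x−1} ∈ [0,1]`, `1 − vZ ∈ (0,1]`, `H^{3s}, H^{3s−1} ≤ 9^{3s}`.
[folklore] -/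
theorem P_pieces {x s : ℚ} (hx : 2 ≤ x) (hs : 3 ≤ s) {Z S H : (Fin 4 → ℝ) → ℝ}
    (hZ : ∀ w, Z w = ((1 - w 2 * (1 - w 0 - w 1)) * (1 - w 2 * w 0) * (1 - w 2 * w 1)) ^ ((1:ℝ)/3))
    (hS : ∀ w, S w = 1 - w 2 * ((1 - w 0 - w 1) * w 0 + (1 - w 0 - w 1) * w 1 + w 0 * w 1) +
      (w 2) ^ 2 * ((1 - w 0 - w 1) * w 0 * w 1))
    (hH : ∀ w, H w = (1 + Z w + Z w ^ 2) / S w) {w : Fin 4 → ℝ}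
    (hw : 0 < w 0 ∧ 0 < w 1 ∧ w 0 + w 1 < 1 ∧ 0 < w 2 ∧ w 2 * (1 - w 0 - w 1) < 1 ∧ w 2 * w 0 < 1 ∧
      w 2 * w 1 < 1 ∧ 0 < w 3 ∧ w 3 < 1) :
    (0 ≤ (w 3) ^ (3 * (x:ℝ) - 1) ∧ (w 3) ^ (3 * (x:ℝ) - 1) ≤ 1) ∧
      (0 < 1 - w 3 * Z w ∧ 1 - w 3 * Z w ≤ 1) ∧
      (0 ≤ H w ^ (3 * (s:ℝ)) ∧ H w ^ (3 * (s:ℝ)) ≤ 9 ^ (3 * (s:ℝ))) ∧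
      (0 ≤ H w ^ (3 * (s:ℝ) - 1) ∧ H w ^ (3 * (s:ℝ) - 1) ≤ 9 ^ (3 * (s:ℝ))) := by
  obtain ⟨hz0, hz1⟩ := Z_mem hZ hw
  obtain ⟨hh0, hh9⟩ := H_mem hZ hS hH hw
  have hv0 : 0 < w 3 := hw.2.2.2.2.2.2.2.1
  have hv1 : w 3 < 1 := hw.2.2.2.2.2.2.2.2
  have hx' : (2:ℝ) ≤ x := by exact_mod_cast hx
  have hs' : (3:ℝ) ≤ s := by exact_mod_cast hs
  refine ⟨⟨rpow_nonneg hv0.le _, rpow_le_one hv0.le hv1.le (by linarith)⟩,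
    ⟨by nlinarith, by nlinarith⟩,
    ⟨rpow_nonneg hh0.le _, rpow_le_rpow hh0.le hh9 (by linarith)⟩,
    ⟨rpow_nonneg hh0.le _, ?_⟩⟩
  exact (rpow_le_rpow hh0.le hh9 (by linarith)).trans
    (rpow_le_rpow_of_exponent_le (by norm_num) (by linarith))

/-- On `W`: `0 ≤ P ≤ 9^{3s}`. [folklore] -/
theorem P_mem {x s : ℚ} (hx : 2 ≤ x) (hs : 3 ≤ s) {Z S H K P : (Fin 4 → ℝ) → ℝ}
    (hZ : ∀ w, Z w = ((1 - w 2 * (1 - w 0 - w 1)) * (1 - w 2 * w 0) * (1 - w 2 * w 1)) ^ ((1:ℝ)/3))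
    (hS : ∀ w, S w = 1 - w 2 * ((1 - w 0 - w 1) * w 0 + (1 - w 0 - w 1) * w 1 + w 0 * w 1) +
      (w 2) ^ 2 * ((1 - w 0 - w 1) * w 0 * w 1))
    (hH : ∀ w, H w = (1 + Z w + Z w ^ 2) / S w)
    (hK : ∀ w, K w = ((1 - w 0 - w 1) * w 0 * w 1) ^ ((s:ℝ) - 1))
    (hP : ∀ w, P w = (w 3) ^ (3 * (x:ℝ) - 1) * (1 - w 3 * Z w) ^ (3 * (s:ℝ) - 1) * H w ^ (3 * (s:ℝ)) *
      K w) {w : Fin 4 → ℝ}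
    (hw : 0 < w 0 ∧ 0 < w 1 ∧ w 0 + w 1 < 1 ∧ 0 < w 2 ∧ w 2 * (1 - w 0 - w 1) < 1 ∧ w 2 * w 0 < 1 ∧
      w 2 * w 1 < 1 ∧ 0 < w 3 ∧ w 3 < 1) :
    0 ≤ P w ∧ P w ≤ 9 ^ (3 * (s:ℝ)) := by
  obtain ⟨⟨a0, a1⟩, ⟨b0, b1⟩, ⟨c0, c1⟩, -⟩ := P_pieces hx hs hZ hS hH hw
  obtain ⟨k0, k1⟩ := K_mem hs hK hw
  have hs' : (3:ℝ) ≤ s := by exact_mod_cast hs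
  have q0 : 0 ≤ (1 - w 3 * Z w) ^ (3 * (s:ℝ) - 1) := rpow_nonneg b0.le _
  have q1 : (1 - w 3 * Z w) ^ (3 * (s:ℝ) - 1) ≤ 1 := rpow_le_one b0.le b1 (by linarith)
  rw [hP]
  refine ⟨by positivity, ?_⟩
  calc (w 3) ^ (3 * (x:ℝ) - 1) * (1 - w 3 * Z w) ^ (3 * (s:ℝ) - 1) * H w ^ (3 * (s:ℝ)) * K w
      ≤ 1 * 1 * 9 ^ (3 * (s:ℝ)) * 1 := by gcongr
    _ = 9 ^ (3 * (s:ℝ)) := by ring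

/-- The two moving box coordinates along `θ₁`: `∂θ₁ t₀ = y`, `∂θ₁ t₁ = −y`. [folklore] -/
theorem hasDerivAt_t (w : Fin 4 → ℝ) :
    HasDerivAt (fun a => 1 - w 2 * (1 - a - w 1)) (w 2) (w 0) ∧
      HasDerivAt (fun a => 1 - w 2 * a) (-w 2) (w 0) ∧
      HasDerivAt (fun a => 1 - a - w 1) (-1) (w 0) := by
  refine ⟨?_, ?_, ?_⟩
  · have h := ((((hasDerivAt_id' (w 0)).const_sub 1).sub_const (w 1)).const_mul (w 2)).const_sub 1
    exact h.congr_deriv (by ring)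
  · have h := ((hasDerivAt_id' (w 0)).const_mul (w 2)).const_sub 1
    exact h.congr_deriv (by ring)
  · exact ((hasDerivAt_id' (w 0)).const_sub 1).sub_const (w 1)

/-- Values of the atoms after updating the `θ₁`-slot. [folklore] -/
theorem update_apply (w : Fin 4 → ℝ) (a : ℝ) :
    Function.update w 0 a 0 = a ∧ Function.update w 0 a 1 = w 1 ∧ Function.update w 0 a 2 = w 2 ∧
      Function.update w 0 a 3 = w 3 := by
  refine ⟨Function.update_self .., Function.update_of_ne (by decide) .., Function.update_of_ne (by decide) ..,
    Function.update_of_ne (by decide) ..⟩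

/-- **`∂θ₁ Z` with its compensated bound** `|∂θ₁Z| · Z² ≤ y/3` on `W`
(`Z = (t₀t₁t₂)^{1/3}`, `∂θ₁Z = (1/3)(t₀t₁t₂)^{−2/3} · y t₂ (t₁ − t₀)`). [folklore] -/
theorem hasDerivAt_Z {Z : (Fin 4 → ℝ) → ℝ}
    (hZ : ∀ w, Z w = ((1 - w 2 * (1 - w 0 - w 1)) * (1 - w 2 * w 0) * (1 - w 2 * w 1)) ^ ((1:ℝ)/3))
    {w : Fin 4 → ℝ}
    (hw : 0 < w 0 ∧ 0 < w 1 ∧ w 0 + w 1 < 1 ∧ 0 < w 2 ∧ w 2 * (1 - w 0 - w 1) < 1 ∧ w 2 * w 0 < 1 ∧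
      w 2 * w 1 < 1 ∧ 0 < w 3 ∧ w 3 < 1) :
    ∃ Z' : ℝ, HasDerivAt (fun a => Z (Function.update w 0 a)) Z' (w 0) ∧ |Z'| * Z w ^ 2 ≤ w 2 / 3 := by
  obtain ⟨-, ⟨h0, h0'⟩, ⟨h1, h1'⟩, ⟨h2, h2'⟩, -⟩ := basic hw
  have hy : 0 < w 2 := hw.2.2.2.1
  obtain ⟨dt0, dt1, -⟩ := hasDerivAt_t w
  have hu : 0 < (1 - w 2 * (1 - w 0 - w 1)) * (1 - w 2 * w 0) * (1 - w 2 * w 1) := by positivity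
  have hd := ((dt0.fun_mul dt1).mul_const (1 - w 2 * w 1)).rpow_const (p := (1:ℝ)/3) (Or.inl hu.ne')
  have hd' : HasDerivAt (fun a => Z (Function.update w 0 a)) _ (w 0) :=
    hd.congr_of_eventuallyEq (Filter.Eventually.of_forall fun a => by simp only [hZ, update_apply])
  refine ⟨_, hd', ?_⟩
  set u := (1 - w 2 * (1 - w 0 - w 1)) * (1 - w 2 * w 0) * (1 - w 2 * w 1) with hu_def
  set X := (w 2 * (1 - w 2 * w 0) + (1 - w 2 * (1 - w 0 - w 1)) * -w 2) * (1 - w 2 * w 1) * ((1:ℝ)/3)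
    with hX_def
  have e : u ^ ((1:ℝ)/3 - 1) * (u ^ ((1:ℝ)/3)) ^ 2 = 1 := by
    rw [← rpow_natCast, ← rpow_mul hu.le, ← rpow_add hu]; norm_num
  have hX : |X| ≤ w 2 / 3 := by
    rw [hX_def, abs_mul, abs_mul, abs_of_pos h2, abs_of_pos (by norm_num : (0:ℝ) < 1/3)]
    have hA : |w 2 * (1 - w 2 * w 0) + (1 - w 2 * (1 - w 0 - w 1)) * -w 2| ≤ w 2 := by
      rw [abs_le]; constructor <;> nlinarith
    calc |w 2 * (1 - w 2 * w 0) + (1 - w 2 * (1 - w 0 - w 1)) * -w 2| * (1 - w 2 * w 1) * (1 / 3)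
        ≤ w 2 * 1 * (1/3) := by gcongr
      _ = w 2 / 3 := by ring
  rw [hZ]
  calc |X * u ^ ((1:ℝ)/3 - 1)| * (u ^ ((1:ℝ)/3)) ^ 2 = |X| * (u ^ ((1:ℝ)/3 - 1) * (u ^ ((1:ℝ)/3)) ^ 2) := by
        rw [abs_mul, abs_of_pos (rpow_pos_of_pos hu _)]; ring
    _ = |X| := by rw [e, mul_one]
    _ ≤ w 2 / 3 := hX

end CornerTheta1

/-- **The atoms of the corner Stokes are bounded on `W`** (sub-goal `cornerStokesTheta1Facts` of
`stub_gmThreeShifted`, `x ≥ 2`, `s ≥ 3`): `Z ∈ (0,1)`, `S ∈ [1/3, 10]`, `H ∈ (0, 9]`, `K ∈ (0, 1]`,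
`P ∈ [0, 9^{3s}]`, and the bracket of `c₀` is `O(y)`: `|θ₀M0 − (1−θ₁)M1 + θ₂M2| ≤ 2xy`.
[cite: KontsevichZagier2001, §1.2 rule (3)] -/
theorem cornerStokesTheta1Facts : ∀ (x s : ℚ), 2 ≤ x → 3 ≤ s → ∀ (Z S H K M0 M1 M2 P : (Fin 4 → ℝ) → ℝ),
    (∀ w, Z w = ((1 - w 2 * (1 - w 0 - w 1)) * (1 - w 2 * w 0) * (1 - w 2 * w 1)) ^ ((1:ℝ)/3)) →
    (∀ w, S w = 1 - w 2 * ((1 - w 0 - w 1) * w 0 + (1 - w 0 - w 1) * w 1 + w 0 * w 1) +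
      (w 2) ^ 2 * ((1 - w 0 - w 1) * w 0 * w 1)) →
    (∀ w, H w = (1 + Z w + Z w ^ 2) / S w) →
    (∀ w, K w = ((1 - w 0 - w 1) * w 0 * w 1) ^ ((s:ℝ) - 1)) →
    (∀ w, M0 w = (1 - w 2 * (1 - w 0 - w 1)) ^ (x:ℝ) * (1 - w 2 * w 0) ^ ((x:ℝ) - 2/3) * (1 - w 2 * w 1) ^ ((x:ℝ) - 1/3)) →
    (∀ w, M1 w = (1 - w 2 * (1 - w 0 - w 1)) ^ ((x:ℝ) - 1/3) * (1 - w 2 * w 0) ^ (x:ℝ) * (1 - w 2 * w 1) ^ ((x:ℝ) - 2/3)) →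
    (∀ w, M2 w = (1 - w 2 * (1 - w 0 - w 1)) ^ ((x:ℝ) - 2/3) * (1 - w 2 * w 0) ^ ((x:ℝ) - 1/3) * (1 - w 2 * w 1) ^ (x:ℝ)) →
    (∀ w, P w = (w 3) ^ (3 * (x:ℝ) - 1) * (1 - w 3 * Z w) ^ (3 * (s:ℝ) - 1) * H w ^ (3 * (s:ℝ)) * K w) →
    ∀ w ∈ {w : Fin 4 → ℝ | 0 < w 0 ∧ 0 < w 1 ∧ w 0 + w 1 < 1 ∧ 0 < w 2 ∧ w 2 * (1 - w 0 - w 1) < 1 ∧ w 2 * w 0 < 1 ∧ w 2 * w 1 < 1 ∧ 0 < w 3 ∧ w 3 < 1},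
      (0 < Z w ∧ Z w < 1) ∧ (1/3 ≤ S w ∧ S w ≤ 10) ∧ (0 < H w ∧ H w ≤ 9) ∧ (0 < K w ∧ K w ≤ 1) ∧
      (0 ≤ P w ∧ P w ≤ 9 ^ (3 * (s:ℝ))) ∧
      |(1 - w 0 - w 1) * M0 w - (1 - w 0) * M1 w + w 1 * M2 w| ≤ 2 * x * w 2 :=
  fun _ _ hx hs _ _ _ _ _ _ _ _ hZ hS hH hK hM0 hM1 hM2 hP _ hw =>
    ⟨CornerTheta1.Z_mem hZ hw, CornerTheta1.S_mem hS hw, CornerTheta1.H_mem hZ hS hH hw,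
      CornerTheta1.K_mem hs hK hw, CornerTheta1.P_mem hx hs hZ hS hH hK hP hw,
      (CornerTheta1.B_bounds hx hZ hM0 hM1 hM2 hw).1⟩

end Summit.KontsevichZagierPeriods.TerasomaMultiplication.MultiplicationAccessible

end
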